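import Mathlib
import Summits.CriticalPhenomena.CardyFormulaZ2.Theorems.CardySelfRefinementGradientComparabilityStubLayerBridgeTransferLinks
import HarnessLib

/-!
# Boundary-layer surgery, brick (S5), part II: the bridge transfer, chain form

Helper file of the registered stub `stub_layerLocalModification` (the deterministic
boundary-layer surgery) of the line `monotone-product-coordinates` (crux
`stmt-CriticalPhenomena-10269`, `…Theses.CardySelfRefinement.GradientComparability`), step (S5):
**transfer of pivotality from a bridge edge to an edge of its contact path**
(`layer_bridgeTransfer_chain`, registered helper).

Setting: a single quad `Q`, mesh `δ = η√2 < 1`, the localised crossing event `A = Aloc 1 ![Q] η`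
(closure semantics: `Q` is crossed inside the drawn open window edges,
`mem_configOf_iff_exists_isCrossing_openEdgeUnion`), and a lattice edge `e = {u, u'}` as in the
cell-contact lemma `quad_noRoom_cellContact` (S4): closed segment in `[Q]` off `∂₀Q ∪ ∂₂Q`
(the (G1)-degeneracies excluded), open segment in `[Q]°`, NO ROOM on either side, NOT DEAD,
and small mesh: `3δ ≤ dist (∂₁Q, ∂₃Q)` and `5δ ≤ dist (∂₀Q, ∂₂Q)`.  If `e` is pivotal for `A`
in `ω`, let `σ = (ω ∖ {e}) ∩ window` (not crossing) — then `σ ∪ {e}` crosses.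

Proof (closure semantics throughout, no general position).
1. (S4) gives a contact `a₀ ∈ ∂_jQ` (`j ∈ {0, 2}`) on a cell-boundary walk from `u`; by
   `5δ ≤ dist (∂₀Q, ∂₂Q)` every contact of either cell beside `e` lies on the same side `∂_jQ`.
2. One-sided decomposition (`exists_link_of_crossing_union`, part I) of the crossing of
   `σ ∪ {e}`: an end `x` of `e` is linked in `σ` to the opposite side `∂_{j+2}Q`.
3. (S4) read from `x` (`quad_noRoom_cellContact_rev` if `x = u'`) gives the contact path
   `x → x + n → x' + n → x'` truncated at `a ∈ ∂_jQ` inside `[Q]`, of one, two or three edges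
   `t₁ = {x, x+n}` (post), `t₂ = {x+n, x'+n}` (rail), `t₃ = {x'+n, x'}` (far post), the last
   one partial.  Hence `σ ∪ {t₁, …, t_L}` crosses (link of `x`, then the path to `a`).
4. Chain: opening the `t_i` one at a time over `σ` in the order `t₁, t₂, t₃` AND in the order
   `t_L, …, t₁`, the first edge whose opening creates a crossing is pivotal for `A` in the
   configuration `(ω ∖ {e}) ∪ {edges opened before}` (`isPivotal_Aloc_one_of_crossing`).
The conclusion records `x, x', n, j, a`, the link of `x`, the contact geometry, and the
outcomes of both orders.  The rail `t₂` is never axial and of the two posts at most one is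
(the one at a coarse end of `e`), so the two orders let the consumer avoid the post at the
coarse end except in the residual case "that post alone, opened over `σ`, already crosses"
(reported in the line's layer-topology report, §wave7B).  No percolation, no named fact.
-/

noncomputable section

namespace Summit.CriticalPhenomena.CardyFormulaZ2.Theorems.CardySelfRefinement

open scoped Topology
open Filter Set MeasureTheory
open Literature.Probability.LatticeModels Literature.Probability.Percolation
open Literature.Probability.Percolation.QuadCrossing
open Summit.CriticalPhenomena.CardyFormulaZ2.Theses.CardySelfRefinement

variable {δ : ℝ}

/-- Points of the cell-boundary walk `u → u + n → u' + n → u'` are within `2δ` of both ends of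
the edge `{u, u'}`. -/
theorem dist_cellWalk_le (hδ : 0 < δ) {u u' n : Site 2} (huu' : (zdGraph 2).Adj u u')
    (hn : (zdGraph 2).Adj u (u + n)) {a p₀ : ℂ}
    (h : a ∈ segment ℝ (meshPoint δ u) (meshPoint δ (u + n)) ∨
      a ∈ segment ℝ (meshPoint δ (u + n)) (meshPoint δ (u' + n)) ∨
      a ∈ segment ℝ (meshPoint δ (u' + n)) (meshPoint δ u'))
    (hp₀ : p₀ = meshPoint δ u ∨ p₀ = meshPoint δ u') : dist a p₀ ≤ 2 * δ := by
  have hn' : (zdGraph 2).Adj u' (u' + n) := by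
    have := LocalParafermionicTemplate.zdGraph_adj_add_right hn (u' - u)
    convert this using 1 <;> abel
  have d1 : dist (meshPoint δ (u + n)) (meshPoint δ u) = δ := by
    rw [dist_eq_norm, norm_meshPoint_sub_eq_of_adj hδ hn]
  have d2 : dist (meshPoint δ (u' + n)) (meshPoint δ u') = δ := by
    rw [dist_eq_norm, norm_meshPoint_sub_eq_of_adj hδ hn']
  have d3 : dist (meshPoint δ u') (meshPoint δ u) = δ := by
    rw [dist_eq_norm, norm_meshPoint_sub_eq_of_adj hδ huu']
  have c0 : dist (meshPoint δ u) p₀ ≤ 2 * δ := by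
    rcases hp₀ with rfl | rfl
    · rw [dist_self]; linarith
    · rw [dist_comm, d3]; linarith
  have c3 : dist (meshPoint δ u') p₀ ≤ 2 * δ := by
    rcases hp₀ with rfl | rfl
    · rw [d3]; linarith
    · rw [dist_self]; linarith
  have c1 : dist (meshPoint δ (u + n)) p₀ ≤ 2 * δ := by
    rcases hp₀ with rfl | rfl
    · rw [d1]; linarith
    · linarith [dist_triangle (meshPoint δ (u + n)) (meshPoint δ u) (meshPoint δ u'),
        dist_comm (meshPoint δ u) (meshPoint δ u')]
  have c2 : dist (meshPoint δ (u' + n)) p₀ ≤ 2 * δ := by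
    rcases hp₀ with rfl | rfl
    · linarith [dist_triangle (meshPoint δ (u' + n)) (meshPoint δ u') (meshPoint δ u)]
    · rw [d2]; linarith
  rcases h with h | h | h
  · exact dist_le_of_mem_segment_ends c0 c1 h
  · exact dist_le_of_mem_segment_ends c1 c2 h
  · exact dist_le_of_mem_segment_ends c2 c3 h

/-- **Bridge transfer, chain form** (brick (S5) of the boundary-layer surgery
`stub_layerLocalModification`; registered helper).  Single quad `Q`, mesh `δ = η√2 < 1`,
`A = Aloc 1 ![Q] η`.  Let `e = {u, u'}` be a lattice edge with closed segment in `[Q]` off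
`∂₀Q ∪ ∂₂Q`, open segment in `[Q]°`, `3δ ≤ dist (∂₁Q, ∂₃Q)`, `5δ ≤ dist (∂₀Q, ∂₂Q)`, NO ROOM and
NOT DEAD (the hypotheses of `quad_noRoom_cellContact`, the latter for the whole drawn lattice as
in `not_isPivotal_Aloc_of_deadFinger`), pivotal for `A` in `ω`.  Then for an end `x` of `e`
(the other end being `x'`), a unit normal `n` of `e`, a side `∂_jQ` (`j ∈ {0, 2}`) and a point
`a ∈ ∂_jQ`: `x` is linked to the opposite side `∂_{j+2}Q` inside the drawing of
`σ = (ω ∖ {e}) ∩ window`, `a` is reached from `x` inside `[Q]` along the walk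
`x → x + n → x' + n → x'` after one, two or three segments (the last partial), and, writing
`ω₀ = ω ∖ {e}`, `t₁ = {x, x+n}`, `t₂ = {x+n, x'+n}`, `t₃ = {x'+n, x'}`: in the one-segment case
`t₁` is pivotal for `A` in `ω₀`; in the two-segment case (`t₁` is pivotal in `ω₀` or `t₂` in
`ω₀ ∪ {t₁}`) and (`t₂` is pivotal in `ω₀` or `t₁` in `ω₀ ∪ {t₂}`); in the three-segment case
(`t₁` in `ω₀`, or `t₂` in `ω₀ ∪ {t₁}`, or `t₃` in `ω₀ ∪ {t₁, t₂}`) and (`t₃` in `ω₀`, or `t₂` in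
`ω₀ ∪ {t₃}`, or `t₁` in `ω₀ ∪ {t₃, t₂}`). -/
theorem layer_bridgeTransfer_chain : ∀ (η : ℝ), 0 < η → η * Real.sqrt 2 < 1 → ∀ (Q : Quad (Set.univ : Set ℂ)) (u u' : Site 2) (ω : BondConfig (Site 2)), (zdGraph 2).Adj u u' → segment ℝ (meshPoint (η * Real.sqrt 2) u) (meshPoint (η * Real.sqrt 2) u') ⊆ Q.carrier → openSegment ℝ (meshPoint (η * Real.sqrt 2) u) (meshPoint (η * Real.sqrt 2) u') ⊆ interior Q.carrier → Disjoint (segment ℝ (meshPoint (η * Real.sqrt 2) u) (meshPoint (η * Real.sqrt 2) u')) (Q.side 0 ∪ Q.side 2) → (∀ z ∈ Q.side 1, ∀ w ∈ Q.side 3, 3 * (η * Real.sqrt 2) ≤ dist z w) → (∀ z ∈ Q.side 0, ∀ w ∈ Q.side 2, 5 * (η * Real.sqrt 2) ≤ dist z w) → (∀ n : Site 2, (zdGraph 2).Adj u (u + n) → u + n ≠ u' → u - n ≠ u' → ¬ (segment ℝ (meshPoint (η * Real.sqrt 2) u) (meshPoint (η * Real.sqrt 2) (u + n)) ∪ segment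 ℝ (meshPoint (η * Real.sqrt 2) (u + n)) (meshPoint (η * Real.sqrt 2) (u' + n)) ∪ segment ℝ (meshPoint (η * Real.sqrt 2) (u' + n)) (meshPoint (η * Real.sqrt 2) u') ⊆ Q.carrier)) → (∀ (β : Set ℂ) (a b m : ℂ) (ρ : ℝ), m ∈ openSegment ℝ (meshPoint (η * Real.sqrt 2) u) (meshPoint (η * Real.sqrt 2) u') → Literature.Topology.PlaneTopology.IsSimpleArc β a b → a ∉ Q.side 0 ∪ Q.side 2 → b ∉ Q.side 0 ∪ Q.side 2 → β \ {a, b} ⊆ interior Q.carrier → β ∩ openEdgeUnion (η * Real.sqrt 2) Set.univ ⊆ {m} → 0 < ρ → Metric.ball m ρ ⊆ interior Q.carrier → β ∩ Metric.ball m ρ = Metric.ball m ρ ∩ {z | inner ℝ (z - m) (meshPoint (η * Real.sqrt 2) u' - meshPoint (η * Real.sqrt 2) u) = 0} → ¬ (a ∈ Q.side 1 ∧ b ∈ Q.side 1 ∨ a ∈ Q.side 3 ∧ b ∈ Q.side 3)) → IsPivotal (Aloc 1 ![Q] η) s(u, u') ω → ∃ (x x' n : Site 2) (j : Fin 4) (a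 : ℂ), (x = u ∧ x' = u' ∨ x = u' ∧ x' = u) ∧ (zdGraph 2).Adj x (x + n) ∧ x + n ≠ x' ∧ x - n ≠ x' ∧ (j = 0 ∨ j = 2) ∧ a ∈ Q.side j ∧ (∃ c ∈ Q.side (j + 2), JoinedIn (Q.carrier ∩ openEdgeUnion (η * Real.sqrt 2) ((ω \ {s(u, u')}) ∩ window 1 ![Q] η)) c (meshPoint (η * Real.sqrt 2) x)) ∧ ((a ∈ segment ℝ (meshPoint (η * Real.sqrt 2) x) (meshPoint (η * Real.sqrt 2) (x + n)) ∧ segment ℝ (meshPoint (η * Real.sqrt 2) x) a ⊆ Q.carrier ∧ IsPivotal (Aloc 1 ![Q] η) s(x, x + n) (ω \ {s(u, u')})) ∨ (a ∈ segment ℝ (meshPoint (η * Real.sqrt 2) (x + n)) (meshPoint (η * Real.sqrt 2) (x' + n)) ∧ segment ℝ (meshPoint (η * Real.sqrt 2) x) (meshPoint (η * Real.sqrt 2) (x + n)) ∪ segment ℝ (meshPoint (η * Real.sqrt 2) (x + n)) a ⊆ Q.carrier ∧ (IsPivotal (Aloc 1 ![Q] η) s(x, x + n) (ω \ {s(u,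 u')}) ∨ IsPivotal (Aloc 1 ![Q] η) s(x + n, x' + n) (ω \ {s(u, u')} ∪ {s(x, x + n)})) ∧ (IsPivotal (Aloc 1 ![Q] η) s(x + n, x' + n) (ω \ {s(u, u')}) ∨ IsPivotal (Aloc 1 ![Q] η) s(x, x + n) (ω \ {s(u, u')} ∪ {s(x + n, x' + n)}))) ∨ (a ∈ segment ℝ (meshPoint (η * Real.sqrt 2) (x' + n)) (meshPoint (η * Real.sqrt 2) x') ∧ segment ℝ (meshPoint (η * Real.sqrt 2) x) (meshPoint (η * Real.sqrt 2) (x + n)) ∪ segment ℝ (meshPoint (η * Real.sqrt 2) (x + n)) (meshPoint (η * Real.sqrt 2) (x' + n)) ∪ segment ℝ (meshPoint (η * Real.sqrt 2) (x' + n)) a ⊆ Q.carrier ∧ (IsPivotal (Aloc 1 ![Q] η) s(x, x + n) (ω \ {s(u, u')}) ∨ IsPivotal (Aloc 1 ![Q] η) s(x + n, x' + n) (ω \ {s(u, u')} ∪ {s(x, x + n)}) ∨ IsPivotal (Aloc 1 ![Q] η) s(x' + n, x') (ω \ {s(u, u')} ∪ {s(x, x + n), s(x + n, x' + n)})) ∧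 (IsPivotal (Aloc 1 ![Q] η) s(x' + n, x') (ω \ {s(u, u')}) ∨ IsPivotal (Aloc 1 ![Q] η) s(x + n, x' + n) (ω \ {s(u, u')} ∪ {s(x' + n, x')}) ∨ IsPivotal (Aloc 1 ![Q] η) s(x, x + n) (ω \ {s(u, u')} ∪ {s(x' + n, x'), s(x + n, x' + n)})))) := by
  intro η hη hη1 Q u u' ω huu' hseg hopen h02 hdist13 hdist02 hroom hND hpiv
  -- notation and the dictionary
  set δ : ℝ := η * Real.sqrt 2 with hδdef
  have hδ : 0 < δ := by positivity
  set W : Set (Sym2 (Site 2)) := window 1 ![Q] η with hW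
  have hWE : W ⊆ (zdGraph 2).edgeSet := by
    intro x hx
    simp only [hW, window, edgesNear, Set.mem_iUnion, Set.mem_inter_iff] at hx
    obtain ⟨-, -, hx⟩ := hx
    exact hx
  set e : Sym2 (Site 2) := s(u, u') with he
  set σ : BondConfig (Site 2) := (ω \ {e}) ∩ W with hσdef
  have hpQ : meshPoint δ u ∈ Q.carrier := hseg (left_mem_segment ℝ _ _)
  have hp'Q : meshPoint δ u' ∈ Q.carrier := hseg (right_mem_segment ℝ _ _)
  have hmem : ∀ ω' : BondConfig (Site 2), ω' ∈ Aloc 1 ![Q] η ↔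
      ∃ K, Q.IsCrossing K ∧ K ⊆ openEdgeUnion δ (ω' ∩ W) := by
    intro ω'
    change (∀ i, ![Q] i ∈ configOf squareLatticeEmbedding.z η Set.univ (ω' ∩ W)) ↔ _
    simp only [Fin.forall_fin_one, Matrix.cons_val_fin_one]
    exact mem_configOf_iff_exists_isCrossing_openEdgeUnion hη (Set.inter_subset_right.trans hWE) Q
  -- pivotality of `e`: `σ` does not cross, `σ ∪ {e}` does
  have hin : insert e ω ∈ Aloc 1 ![Q] η ∧ ω \ {e} ∉ Aloc 1 ![Q] η := by
    rcases hpiv with ⟨ha, hb⟩ | ⟨ha, hb⟩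
    · exact ⟨ha, hb⟩
    · exact absurd (isUpperSet_Aloc 1 ![Q] η (Set.sdiff_subset.trans (Set.subset_insert e ω)) ha) hb
  obtain ⟨hin, hout⟩ := hin
  rw [hmem] at hin hout
  have hσ : ¬ ∃ a ∈ Q.side 0, ∃ b ∈ Q.side 2, JoinedIn (Q.carrier ∩ openEdgeUnion δ σ) a b :=
    fun h => hout ((exists_isCrossing_iff_joinedIn hδ Q σ).2 h)
  have hsub_e : insert e ω ∩ W ⊆ σ ∪ {e} := by
    rintro x ⟨hx, hxW⟩
    rcases Set.mem_insert_iff.1 hx with rfl | hxω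
    · exact Or.inr rfl
    · by_cases hxe : x = e
      · exact Or.inr hxe
      · exact Or.inl ⟨⟨hxω, hxe⟩, hxW⟩
  have hcr : ∃ a ∈ Q.side 0, ∃ b ∈ Q.side 2,
      JoinedIn (Q.carrier ∩ openEdgeUnion δ (σ ∪ {e})) a b := by
    refine (exists_isCrossing_iff_joinedIn hδ Q _).1 ?_
    obtain ⟨K, hK, hKX⟩ := hin
    exact ⟨K, hK, hKX.trans (openEdgeUnion_mono δ hsub_e)⟩
  -- Step 1: the contact from `u` fixes the side `j`
  obtain ⟨n₀, hn₀, hne₀, hne₀', a₀, ha₀, halt₀⟩ :=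
    quad_noRoom_cellContact _ δ hδ Q u u' huu' hseg hopen hdist13 hroom hND
  obtain ⟨j, hj, ha₀j⟩ : ∃ j : Fin 4, (j = 0 ∨ j = 2) ∧ a₀ ∈ Q.side j := by
    rcases ha₀ with h | h
    exacts [⟨0, Or.inl rfl, h⟩, ⟨2, Or.inr rfl, h⟩]
  have h02' : (0 : Fin 4) + 2 = 2 := by decide
  have h22 : (2 : Fin 4) + 2 = 0 := by decide
  have hj2 : j + 2 = 0 ∨ j + 2 = 2 := by
    rcases hj with rfl | rfl
    exacts [Or.inr h02', Or.inl h22]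
  have hfar : ∀ z ∈ Q.side j, ∀ w ∈ Q.side (j + 2), 5 * δ ≤ dist z w := by
    rcases hj with rfl | rfl
    · rw [h02']; exact hdist02
    · rw [h22]; intro z hz w hw; rw [dist_comm]; exact hdist02 w hw z hz
  have hside : ∀ a₁ ∈ Q.side 0 ∪ Q.side 2, a₁ ∉ Q.side (j + 2) → a₁ ∈ Q.side j := by
    intro a₁ ha₁ hnot
    rcases hj with rfl | rfl
    · rw [h02'] at hnot
      exact ha₁.resolve_right hnot
    · rw [h22] at hnot
      exact ha₁.resolve_left hnot
  -- Step 2: an end `x` of `e` linked in `σ` to the opposite side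
  have heσ : ∀ f ∈ ({e} : BondConfig (Site 2)), f ∉ σ := fun f hf hfσ => hfσ.1.2 hf
  have hdre : ∀ z ∈ openEdgeUnion δ ({e} : BondConfig (Site 2)), z ∉ Q.side (j + 2) := by
    intro z hz hzj
    refine Set.disjoint_left.1 h02 (openEdgeUnion_singleton_subset δ u u' hz) ?_
    rcases hj2 with h | h
    · rw [h] at hzj; exact Or.inl hzj
    · rw [h] at hzj; exact Or.inr hzj
  obtain ⟨x, ⟨y, -, hxy⟩, hlink⟩ :=
    exists_link_of_crossing_union _ δ hδ Q σ {e} (j + 2) hj2 heσ hdre hσ hcr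
  have hx : x = u ∨ x = u' := eq_or_eq_of_sym2_eq (mem_singleton_iff.1 hxy)
  -- Step 3: the contact from `x`, on the side `j`
  obtain ⟨x', n, a, hor, hxn, hne, hne', haj, halt⟩ : ∃ (x' n : Site 2) (a : ℂ),
      (x = u ∧ x' = u' ∨ x = u' ∧ x' = u) ∧ (zdGraph 2).Adj x (x + n) ∧ x + n ≠ x' ∧
      x - n ≠ x' ∧ a ∈ Q.side j ∧
      ((a ∈ segment ℝ (meshPoint δ x) (meshPoint δ (x + n)) ∧
          segment ℝ (meshPoint δ x) a ⊆ Q.carrier) ∨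
        (a ∈ segment ℝ (meshPoint δ (x + n)) (meshPoint δ (x' + n)) ∧
          segment ℝ (meshPoint δ x) (meshPoint δ (x + n)) ∪
            segment ℝ (meshPoint δ (x + n)) a ⊆ Q.carrier) ∨
        (a ∈ segment ℝ (meshPoint δ (x' + n)) (meshPoint δ x') ∧
          segment ℝ (meshPoint δ x) (meshPoint δ (x + n)) ∪
            segment ℝ (meshPoint δ (x + n)) (meshPoint δ (x' + n)) ∪
            segment ℝ (meshPoint δ (x' + n)) a ⊆ Q.carrier)) := by
    rcases hx with rfl | rfl
    · exact ⟨u', n₀, a₀, Or.inl ⟨rfl, rfl⟩, hn₀, hne₀, hne₀', ha₀j, halt₀⟩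
    · obtain ⟨n₁, hn₁, hne₁, hne₁', a₁, ha₁, halt₁⟩ :=
        quad_noRoom_cellContact_rev hδ Q huu' hseg hopen hdist13 hroom hND
      refine ⟨u, n₁, a₁, Or.inr ⟨rfl, rfl⟩, hn₁, hne₁, hne₁', hside a₁ ha₁ fun ha₁' => ?_, halt₁⟩
      have hd₀ : dist a₀ (meshPoint δ u) ≤ 2 * δ :=
        dist_cellWalk_le hδ huu' hn₀ (halt₀.imp And.left (Or.imp And.left And.left))
          (Or.inl rfl)
      have hd₁ : dist a₁ (meshPoint δ u) ≤ 2 * δ :=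
        dist_cellWalk_le hδ huu'.symm hn₁ (halt₁.imp And.left (Or.imp And.left And.left))
          (Or.inr rfl)
      have h5 := hfar a₀ ha₀j a₁ ha₁'
      have h4 : dist a₀ a₁ ≤ 4 * δ := by
        have := dist_triangle a₀ (meshPoint δ u) a₁
        rw [dist_comm (meshPoint δ u) a₁] at this
        linarith
      linarith
  -- common bookkeeping for the three edges `t₁, t₂, t₃`
  have hxx' : (zdGraph 2).Adj x x' := by
    rcases hor with ⟨rfl, rfl⟩ | ⟨rfl, rfl⟩
    exacts [huu', huu'.symm]
  have hPx : meshPoint δ x ∈ Q.carrier := by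
    rcases hor with ⟨rfl, rfl⟩ | ⟨rfl, rfl⟩
    exacts [hpQ, hp'Q]
  have hPx' : meshPoint δ x' ∈ Q.carrier := by
    rcases hor with ⟨rfl, rfl⟩ | ⟨rfl, rfl⟩
    exacts [hp'Q, hpQ]
  have hadj₂ : (zdGraph 2).Adj (x + n) (x' + n) := LocalParafermionicTemplate.zdGraph_adj_add_right hxx' n
  have hadj₃ : (zdGraph 2).Adj x' (x' + n) := by
    have := LocalParafermionicTemplate.zdGraph_adj_add_right hxn (x' - x)
    convert this using 1 <;> abel
  have hδ1 : δ < 1 := hη1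
  have ht₁W : s(x, x + n) ∈ W :=
    mem_window_one_of_dist_lt Q hxn hPx (by rw [dist_self]; exact zero_lt_one)
  have ht₂W : s(x + n, x' + n) ∈ W :=
    mem_window_one_of_dist_lt Q hadj₂ hPx (by rwa [dist_eq_norm, norm_meshPoint_sub_eq_of_adj hδ hxn])
  have ht₃W : s(x' + n, x') ∈ W := by
    rw [Sym2.eq_swap]
    exact mem_window_one_of_dist_lt Q hadj₃ hPx' (by rw [dist_self]; exact zero_lt_one)
  -- drawn segments of the three edges
  have hs₁ : ∀ T : BondConfig (Site 2), s(x, x + n) ∈ T →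
      segment ℝ (meshPoint δ x) (meshPoint δ (x + n)) ⊆ openEdgeUnion δ T :=
    fun T h => segment_subset_openEdgeUnion' δ hxn h
  have hs₂ : ∀ T : BondConfig (Site 2), s(x + n, x' + n) ∈ T →
      segment ℝ (meshPoint δ (x + n)) (meshPoint δ (x' + n)) ⊆ openEdgeUnion δ T :=
    fun T h => segment_subset_openEdgeUnion' δ hadj₂ h
  have hs₃ : ∀ T : BondConfig (Site 2), s(x' + n, x') ∈ T →
      segment ℝ (meshPoint δ (x' + n)) (meshPoint δ x') ⊆ openEdgeUnion δ T :=
    fun T h => segment_subset_openEdgeUnion' δ hadj₃.symm h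
  have hsubseg : ∀ {q q' : ℂ}, a ∈ segment ℝ q q' → segment ℝ q a ⊆ segment ℝ q q' :=
    fun {q q'} h => (convex_segment q q').segment_subset (left_mem_segment ℝ q q') h
  -- crossings (path form) and their monotonicity
  have hmono : ∀ T T' : BondConfig (Site 2), T ⊆ T' →
      (∃ a' ∈ Q.side 0, ∃ b' ∈ Q.side 2, JoinedIn (Q.carrier ∩ openEdgeUnion δ T) a' b') →
      ∃ a' ∈ Q.side 0, ∃ b' ∈ Q.side 2, JoinedIn (Q.carrier ∩ openEdgeUnion δ T') a' b' :=
    fun T T' h ⟨a', ha', b', hb', hJ⟩ => ⟨a', ha', b', hb', joinedIn_mono_config δ Q h hJ⟩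
  have hcross : ∀ T : BondConfig (Site 2),
      JoinedIn (Q.carrier ∩ openEdgeUnion δ T) (meshPoint δ x) a →
      ∃ a' ∈ Q.side 0, ∃ b' ∈ Q.side 2, JoinedIn (Q.carrier ∩ openEdgeUnion δ (σ ∪ T)) a' b' := by
    intro T hT
    obtain ⟨c, hc, hJc⟩ := hlink
    have hJ : JoinedIn (Q.carrier ∩ openEdgeUnion δ (σ ∪ T)) c a :=
      (joinedIn_mono_config δ Q Set.subset_union_left hJc).trans
        (joinedIn_mono_config δ Q Set.subset_union_right hT)
    rcases hj with rfl | rfl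
    · rw [h02'] at hc
      exact ⟨a, haj, c, hc, hJ.symm⟩
    · rw [h22] at hc
      exact ⟨c, hc, a, haj, hJ⟩
  -- the pivotality producer
  have hpv : ∀ (S' : BondConfig (Site 2)) (t : Sym2 (Site 2)), S' ⊆ W → t ∈ W →
      (∃ a' ∈ Q.side 0, ∃ b' ∈ Q.side 2,
        JoinedIn (Q.carrier ∩ openEdgeUnion δ (σ ∪ insert t S')) a' b') →
      (¬ ∃ a' ∈ Q.side 0, ∃ b' ∈ Q.side 2,
        JoinedIn (Q.carrier ∩ openEdgeUnion δ (σ ∪ S')) a' b') →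
      IsPivotal (Aloc 1 ![Q] η) t ((ω \ {e}) ∪ S') := by
    intro S' t hS'W htW hyes hno
    refine isPivotal_Aloc_one_of_crossing hη Q htW ?_ ?_
    · obtain ⟨K, hK, hKX⟩ := (exists_isCrossing_iff_joinedIn hδ Q _).2 hyes
      refine ⟨K, hK, hKX.trans (openEdgeUnion_mono δ ?_)⟩
      rintro f (hf | rfl | hf)
      · exact mem_insert_of_mem _ ⟨Or.inl hf.1, hf.2⟩
      · exact mem_insert _ _
      · exact mem_insert_of_mem _ ⟨Or.inr hf, hS'W hf⟩
    · rintro ⟨K, hK, hKX⟩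
      refine hno ((exists_isCrossing_iff_joinedIn hδ Q _).1
        ⟨K, hK, hKX.trans (openEdgeUnion_mono δ ?_)⟩)
      rintro f ⟨hf | hf, hfW⟩
      · exact Or.inl ⟨hf, hfW⟩
      · exact Or.inr hf
  have hpv₀ : ∀ t : Sym2 (Site 2), t ∈ W →
      (∃ a' ∈ Q.side 0, ∃ b' ∈ Q.side 2,
        JoinedIn (Q.carrier ∩ openEdgeUnion δ (σ ∪ {t})) a' b') →
      IsPivotal (Aloc 1 ![Q] η) t (ω \ {e}) := by
    intro t htW hyes
    have key := hpv ∅ t (empty_subset _) htW (by rwa [← Set.singleton_def])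
      (by rwa [Set.union_empty])
    rwa [Set.union_empty] at key
  -- joins along the contact path
  have hJ₁ : ∀ T : BondConfig (Site 2), s(x, x + n) ∈ T →
      segment ℝ (meshPoint δ x) (meshPoint δ (x + n)) ⊆ Q.carrier →
      JoinedIn (Q.carrier ∩ openEdgeUnion δ T) (meshPoint δ x) (meshPoint δ (x + n)) :=
    fun T h hQ => JoinedIn.of_segment_subset (subset_inter hQ (hs₁ T h))
  have hJ₂ : ∀ T : BondConfig (Site 2), s(x + n, x' + n) ∈ T →
      segment ℝ (meshPoint δ (x + n)) (meshPoint δ (x' + n)) ⊆ Q.carrier →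
      JoinedIn (Q.carrier ∩ openEdgeUnion δ T) (meshPoint δ (x + n)) (meshPoint δ (x' + n)) :=
    fun T h hQ => JoinedIn.of_segment_subset (subset_inter hQ (hs₂ T h))
  refine ⟨x, x', n, j, a, hor, hxn, hne, hne', hj, haj, hlink, ?_⟩
  rcases halt with ⟨ha, hQa⟩ | ⟨ha, hQa⟩ | ⟨ha, hQa⟩
  · -- one segment: `t₁` is pivotal in `ω₀`
    refine Or.inl ⟨ha, hQa, hpv₀ _ ht₁W (hcross {s(x, x + n)} ?_)⟩
    exact JoinedIn.of_segment_subset (subset_inter hQa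
      ((hsubseg ha).trans (hs₁ _ (mem_singleton _))))
  · -- two segments
    have hQ₁ : segment ℝ (meshPoint δ x) (meshPoint δ (x + n)) ⊆ Q.carrier :=
      Set.subset_union_left.trans hQa
    have hyes : ∃ a' ∈ Q.side 0, ∃ b' ∈ Q.side 2, JoinedIn (Q.carrier ∩ openEdgeUnion δ
        (σ ∪ {s(x, x + n), s(x + n, x' + n)})) a' b' := by
      refine hcross _ ((hJ₁ _ (mem_insert _ _) hQ₁).trans ?_)
      exact JoinedIn.of_segment_subset (subset_inter (Set.subset_union_right.trans hQa)
        ((hsubseg ha).trans (hs₂ _ (mem_insert_of_mem _ (mem_singleton _)))))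
    refine Or.inr (Or.inl ⟨ha, hQa, ?_, ?_⟩)
    · by_cases C₁ : ∃ a' ∈ Q.side 0, ∃ b' ∈ Q.side 2,
          JoinedIn (Q.carrier ∩ openEdgeUnion δ (σ ∪ {s(x, x + n)})) a' b'
      · exact Or.inl (hpv₀ _ ht₁W C₁)
      · refine Or.inr (hpv {s(x, x + n)} _ (singleton_subset_iff.2 ht₁W) ht₂W
          (hmono _ _ (Set.union_subset_union_right σ ?_) hyes) C₁)
        intro f hf
        simp only [mem_insert_iff, mem_singleton_iff] at hf ⊢
        rcases hf with h | h
        exacts [Or.inr h, Or.inl h]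
    · by_cases C₂ : ∃ a' ∈ Q.side 0, ∃ b' ∈ Q.side 2,
          JoinedIn (Q.carrier ∩ openEdgeUnion δ (σ ∪ {s(x + n, x' + n)})) a' b'
      · exact Or.inl (hpv₀ _ ht₂W C₂)
      · exact Or.inr (hpv {s(x + n, x' + n)} _ (singleton_subset_iff.2 ht₂W) ht₁W hyes C₂)
  · -- three segments
    have hQ₁ : segment ℝ (meshPoint δ x) (meshPoint δ (x + n)) ⊆ Q.carrier :=
      (Set.subset_union_left.trans Set.subset_union_left).trans hQa
    have hQ₂ : segment ℝ (meshPoint δ (x + n)) (meshPoint δ (x' + n)) ⊆ Q.carrier :=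
      (Set.subset_union_right.trans Set.subset_union_left).trans hQa
    have hyes : ∃ a' ∈ Q.side 0, ∃ b' ∈ Q.side 2, JoinedIn (Q.carrier ∩ openEdgeUnion δ
        (σ ∪ {s(x, x + n), s(x + n, x' + n), s(x' + n, x')})) a' b' := by
      refine hcross _ (((hJ₁ _ (mem_insert _ _) hQ₁).trans
        (hJ₂ _ (mem_insert_of_mem _ (mem_insert _ _)) hQ₂)).trans ?_)
      exact JoinedIn.of_segment_subset (subset_inter (Set.subset_union_right.trans hQa)
        ((hsubseg ha).trans
          (hs₃ _ (mem_insert_of_mem _ (mem_insert_of_mem _ (mem_singleton _))))))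
    have hperm : ∀ X : BondConfig (Site 2),
        (∀ f, f ∈ X ↔ f = s(x, x + n) ∨ f = s(x + n, x' + n) ∨ f = s(x' + n, x')) →
        ∃ a' ∈ Q.side 0, ∃ b' ∈ Q.side 2,
          JoinedIn (Q.carrier ∩ openEdgeUnion δ (σ ∪ X)) a' b' := by
      intro X hX
      refine hmono _ _ (Set.union_subset_union_right σ fun f hf => ?_) hyes
      rw [hX]
      simpa only [mem_insert_iff, mem_singleton_iff] using hf
    refine Or.inr (Or.inr ⟨ha, hQa, ?_, ?_⟩)
    · by_cases C₁ : ∃ a' ∈ Q.side 0, ∃ b' ∈ Q.side 2,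
          JoinedIn (Q.carrier ∩ openEdgeUnion δ (σ ∪ {s(x, x + n)})) a' b'
      · exact Or.inl (hpv₀ _ ht₁W C₁)
      by_cases C₁₂ : ∃ a' ∈ Q.side 0, ∃ b' ∈ Q.side 2,
          JoinedIn (Q.carrier ∩ openEdgeUnion δ (σ ∪ {s(x, x + n), s(x + n, x' + n)})) a' b'
      · refine Or.inr (Or.inl (hpv {s(x, x + n)} _ (singleton_subset_iff.2 ht₁W) ht₂W
          (hmono _ _ (Set.union_subset_union_right σ ?_) C₁₂) C₁))
        intro f hf
        simp only [mem_insert_iff, mem_singleton_iff] at hf ⊢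
        rcases hf with h | h
        exacts [Or.inr h, Or.inl h]
      · refine Or.inr (Or.inr (hpv {s(x, x + n), s(x + n, x' + n)} _ ?_ ht₃W
          (hperm _ fun f => ?_) C₁₂))
        · rintro f (rfl | rfl)
          exacts [ht₁W, ht₂W]
        · simp only [mem_insert_iff, mem_singleton_iff]
          constructor
          · rintro (h | h | h)
            exacts [Or.inr (Or.inr h), Or.inl h, Or.inr (Or.inl h)]
          · rintro (h | h | h)
            exacts [Or.inr (Or.inl h), Or.inr (Or.inr h), Or.inl h]
    · by_cases C₃ : ∃ a' ∈ Q.side 0, ∃ b' ∈ Q.side 2,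
          JoinedIn (Q.carrier ∩ openEdgeUnion δ (σ ∪ {s(x' + n, x')})) a' b'
      · exact Or.inl (hpv₀ _ ht₃W C₃)
      by_cases C₃₂ : ∃ a' ∈ Q.side 0, ∃ b' ∈ Q.side 2,
          JoinedIn (Q.carrier ∩ openEdgeUnion δ (σ ∪ {s(x' + n, x'), s(x + n, x' + n)})) a' b'
      · refine Or.inr (Or.inl (hpv {s(x' + n, x')} _ (singleton_subset_iff.2 ht₃W) ht₂W
          (hmono _ _ (Set.union_subset_union_right σ ?_) C₃₂) C₃))
        intro f hf
        simp only [mem_insert_iff, mem_singleton_iff] at hf ⊢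
        rcases hf with h | h
        exacts [Or.inr h, Or.inl h]
      · refine Or.inr (Or.inr (hpv {s(x' + n, x'), s(x + n, x' + n)} _ ?_ ht₁W
          (hperm _ fun f => ?_) C₃₂))
        · rintro f (rfl | rfl)
          exacts [ht₃W, ht₂W]
        · simp only [mem_insert_iff, mem_singleton_iff]
          constructor
          · rintro (h | h | h)
            exacts [Or.inl h, Or.inr (Or.inr h), Or.inr (Or.inl h)]
          · rintro (h | h | h)
            exacts [Or.inl h, Or.inr (Or.inr h), Or.inr (Or.inl h)]

end Summit.CriticalPhenomena.CardyFormulaZ2.Theorems.CardySelfRefinement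

end
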